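import Summits.QuantumFields.BalabanUV.Beta.D1BFx.NeedleGhostBubbleRowClosed
import Summits.QuantumFields.BalabanUV.Beta.D1BFx.NeedleGhostTadpoleRowClosed
import Summits.QuantumFields.BalabanUV.Beta.D1BFx.NeedleGhostBubble2Row

/-!
# `BalabanUV.Beta.D1BFx.NeedleRowsAtRay` — road «BF-x», binder row D1, slot (K), END row `hGrp gN`: **THE NEEDLE TABLE ROWS' SCALING LETTERS DISCHARGED
# AT THE RAY OF RECORD FROM THE END's OWN WEIGHT HYPOTHESES** (`hω : ωgh·cK² = −2·ωgl·cE²`, `hlam : ωgl·cE² = 2N²·n⁸`) and the ghost-sector ray pins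
# (`cK = cgh·n²`, `cQ = cgh·a`, `x₀ = −cgh`) — owner «ROWS-AT-RAY» (FINDING U-1, ruling ρ-g9-29): T₇ (leaf-04-g8's closer) and T₄∕T₅ (gan24-leaf-05-g41's closer, M10 inside)

HONEST DEPENDENCY (cell records, verbatim): «continuum YM on T⁴ ⇐ BetaPertH ∧ nine spine estimates (0/9 proved); BetaPertH ⇐ (D1) ∧ (D4) ∧
CAP+tail; G-an2-4 gates asym, D1 and NE2/3/4.»  HONEST FRAMING (cell contract, verbatim): «discharging `BetaPertH` makes Bałaban's UV stability
UNCONDITIONAL — a real constructive-QFT result; it is NOT the continuum limit and NOT the Clay problem.»  THIS MODULE DISCHARGES NOTHING of the wall: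
[folklore] arithmetic BY NAME — the displayed scalar letters `|ωgh n·(x₀ n·cQ n)| ≤ k·n⁴` (T₇, leaf-04-g8's `NeedleGhostTadpoleRowSharp`∕closer) and `|ωgh n·(cK n·cQ n)| ≤ k·n⁶` of `NeedleGhostBubbleRowClosed.h₄∕h₅_of_scaling` (gan24-leaf-05-g41) are COMPUTED
from the END's weight hypotheses `hω`∕`hlam` (`RoadEndBFxTotalShellGroups.d1Drift_BFx_total_shell_of_prop12_of_groups`) and the ray pins of the ghost
sector (the pinning on which `GhostAveragingSquare.hasSum_row_fineHessA_ghost` delivers the END's `hrowgh`; `RoadEndBFxRecutRay`): `ωgh·x₀·cQ = 4N²a·n⁴`, `ωgh·cK·cQ = −4N²a·n⁶` EXACTLY, so `k := 4N²a` in both.  The ray pins stay DISPLAYED (they are the (A2) dictionary's ghost lines, not proved here).  No `def`, no `def … : Prop`,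
nothing cited, 0 sorry.  0 wall binders (root-level hW ∕ hR-sockets ∕ hSX-socket ∕ D1Tel ∕ D1Rep — 0); (K) NOT closed; NOT D1, NOT `BetaPertH`, NOT continuum, NOT Clay.

ABSOLUTE RULE (cell charter, verbatim): «No internally-minted statement may enter as a cited fact. Every hypothesis is either kernel-proved in this
package or a verbatim quotation of a PUBLISHED theorem with page reference. The manuscript(s) under audit are NOT citable for their own disputed
steps — they are the thing under adjudication; programme-internal (2001/route/tribunal) claims are never citable.»

CONTENT.
* §1 [folklore] `ωgh_mul_cgh_sq_of_ray` (`ωgh·cgh² = −4N²n⁴`), `weight₇_eq_of_ray`: `hω`, `hlam`, the ray pins ⊢ `ωgh n·(x₀ n·cQ n) = 4N²a·n⁴` (`n ≥ 2`); `abs_weight₇_le_of_ray`.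
* §2∕§5 (v1.1, APPENDED 2026-08-21 after `NeedleGhostTadpoleRowClosed` p258607 landed) **`h₇_of_ray`**: `h₇` of `NeedleRowGlue.abs_gN_row_le_of_tables` VERBATIM with
  `C₇ := 4N²a·(cNear a + 2∕min 2 a)`, displayed ONLY `0 < a`, `hω`, `hlam` and the three ray pins — leaf-04-g8's closer `h₇_of_scaling` with its letter computed here.
Unit `b2b-balaban-beta-d1-p2` (gen 9), road «BF-x» OWNER, BINDER-OWNERS row D1 co-owner.
-/

noncomputable section

namespace Summit.QuantumFields.BalabanUV.Beta.D1BFx.NeedleRowsAtRay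

open Finset Filter Topology
open scoped BigOperators
open Literature.MathematicalPhysics.QuantumFieldTheory.Balaban1983to89
open Literature.MathematicalPhysics.QuantumFieldTheory.Balaban1983to89.Beta
open DyadicShell (Pt toReal)
open WindowIdentification (fullSum)
open DressedMomentNormalisation (resSite)
open Summit.QuantumFields.BalabanUV.Beta.D1BFx.DressedTablesLeg (tadpoleTableA)
open Summit.QuantumFields.BalabanUV.Beta.D1BFx.GhostLeg (Ggh)
open Summit.QuantumFields.BalabanUV.Beta.D1BFx.GhostStencilRootedReflection (ctrHalf)
open Summit.QuantumFields.BalabanUV.Beta.D1BFx.GhostAveragingSquare (WghAt)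
open Summit.QuantumFields.BalabanUV.Beta.D1BFx.GhostStencil (ghCur)
open Summit.QuantumFields.BalabanUV.Beta.D1BFx.GhostStencilRooted (qAntiAt)
open Summit.QuantumFields.BalabanUV.Beta.D1BFx.FineHessianSectors (biBubbleTable)
open Summit.QuantumFields.BalabanUV.Beta.D1BFx.GhostLegFree (ghDelta)
open Summit.QuantumFields.BalabanUV.Beta.D1BFx.GhostLegBlockMass (cNear)
open B4Sect5Proof (latticeConst)
open Summit.QuantumFields.BalabanUV.Beta.D1BFx.NeedleGhostBubbleRowClosed (h₄_of_scaling h₅_of_scaling)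

variable {a N : ℝ} {x₀ cK cQ cE cgh ωgl ωgh : ℕ → ℝ}

/-! ## §1 The T₇ weight product at the ray -/

/-- [folklore] `ωgh n·cgh n² = −4N²·n⁴` at the ray (the common core of the three weight products). -/
theorem ωgh_mul_cgh_sq_of_ray (hω : ∀ n : ℕ, 2 ≤ n → ωgh n * cK n ^ 2 = -2 * (ωgl n * cE n ^ 2))
    (hlam : ∀ n : ℕ, 2 ≤ n → ωgl n * cE n ^ 2 = 2 * N ^ 2 * (n : ℝ) ^ 8) (hK : ∀ n : ℕ, cK n = cgh n * (n : ℝ) ^ 2)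
    (n : ℕ) (hn : 2 ≤ n) : ωgh n * cgh n ^ 2 = -(4 * N ^ 2 * (n : ℝ) ^ 4) := by
  have hn0 : (n : ℝ) ≠ 0 := by exact_mod_cast (show n ≠ 0 by omega)
  have h4 : (n : ℝ) ^ 4 ≠ 0 := pow_ne_zero 4 hn0
  have h1 : ωgh n * cgh n ^ 2 * (n : ℝ) ^ 4 = -(4 * N ^ 2 * (n : ℝ) ^ 8) := by
    have h := hω n hn
    rw [hlam n hn, hK n] at h
    have e : ωgh n * (cgh n * (n : ℝ) ^ 2) ^ 2 = ωgh n * cgh n ^ 2 * (n : ℝ) ^ 4 := by ring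
    rw [e] at h
    linarith
  have e : (ωgh n * cgh n ^ 2 + 4 * N ^ 2 * (n : ℝ) ^ 4) * (n : ℝ) ^ 4 = 0 := by
    have : (n : ℝ) ^ 8 = (n : ℝ) ^ 4 * (n : ℝ) ^ 4 := by ring
    rw [this] at h1
    linarith
  have := (mul_eq_zero.1 e).resolve_right h4
  linarith

/-- [folklore] **THE T₇ WEIGHT PRODUCT AT THE RAY OF RECORD**: from `ωgh·cK² = −2·(ωgl·cE²)`, `ωgl·cE² = 2N²·n⁸` and the pins `cK = cgh·n²`, `cQ = cgh·a`,
`x₀ = −cgh`: `ωgh n·(x₀ n·cQ n) = 4N²a·n⁴` (every `n ≥ 2`; `cgh n` drops out, zero or not). -/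
theorem weight₇_eq_of_ray (hω : ∀ n : ℕ, 2 ≤ n → ωgh n * cK n ^ 2 = -2 * (ωgl n * cE n ^ 2))
    (hlam : ∀ n : ℕ, 2 ≤ n → ωgl n * cE n ^ 2 = 2 * N ^ 2 * (n : ℝ) ^ 8)
    (hK : ∀ n : ℕ, cK n = cgh n * (n : ℝ) ^ 2) (hQ : ∀ n : ℕ, cQ n = cgh n * a) (hx : ∀ n : ℕ, x₀ n = -cgh n)
    (n : ℕ) (hn : 2 ≤ n) : ωgh n * (x₀ n * cQ n) = 4 * N ^ 2 * a * (n : ℝ) ^ 4 := by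
  have h2 := ωgh_mul_cgh_sq_of_ray hω hlam hK n hn
  rw [hx n, hQ n]
  have e : ωgh n * (-cgh n * (cgh n * a)) = -(ωgh n * cgh n ^ 2) * a := by ring
  rw [e, h2]
  ring

/-- [folklore] Hence the sharp row's scaling letter holds with `k = 4N²a` (`0 ≤ a`). -/
theorem abs_weight₇_le_of_ray (ha : 0 ≤ a) (hω : ∀ n : ℕ, 2 ≤ n → ωgh n * cK n ^ 2 = -2 * (ωgl n * cE n ^ 2))
    (hlam : ∀ n : ℕ, 2 ≤ n → ωgl n * cE n ^ 2 = 2 * N ^ 2 * (n : ℝ) ^ 8)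
    (hK : ∀ n : ℕ, cK n = cgh n * (n : ℝ) ^ 2) (hQ : ∀ n : ℕ, cQ n = cgh n * a) (hx : ∀ n : ℕ, x₀ n = -cgh n) :
    ∀ n : ℕ, 2 ≤ n → |ωgh n * (x₀ n * cQ n)| ≤ 4 * N ^ 2 * a * (n : ℝ) ^ 4 := by
  intro n hn
  rw [weight₇_eq_of_ray hω hlam hK hQ hx n hn, abs_of_nonneg (by positivity)]

/-! ## §2 The T₇ row at the ray — `h₇_of_ray := NeedleGhostTadpoleRowClosed.h₇_of_scaling ha (abs_weight₇_le_of_ray …) μ ν` is APPENDED (v1.1) once leaf-04-g8's closer lands -/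

/-! ## §3 The T₄∕T₅ and T₆ weight letters at the ray -/

/-- [folklore] **THE T₄∕T₅ WEIGHT PRODUCT AT THE RAY**: `ωgh n·(cK n·cQ n) = −4N²a·n⁶`, hence `|ωgh n·(cK n·cQ n)| ≤ 4N²a·n⁶` — the letter of
`NeedleGhostBubbleRowClosed.h₄_of_scaling`∕`h₅_of_scaling` with `k = 4N²a`. -/
theorem abs_weight₄_le_of_ray (ha : 0 ≤ a) (hω : ∀ n : ℕ, 2 ≤ n → ωgh n * cK n ^ 2 = -2 * (ωgl n * cE n ^ 2))
    (hlam : ∀ n : ℕ, 2 ≤ n → ωgl n * cE n ^ 2 = 2 * N ^ 2 * (n : ℝ) ^ 8)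
    (hK : ∀ n : ℕ, cK n = cgh n * (n : ℝ) ^ 2) (hQ : ∀ n : ℕ, cQ n = cgh n * a) :
    ∀ n : ℕ, 2 ≤ n → |ωgh n * (cK n * cQ n)| ≤ 4 * N ^ 2 * a * (n : ℝ) ^ 6 := by
  intro n hn
  have h2 := ωgh_mul_cgh_sq_of_ray hω hlam hK n hn
  have e : ωgh n * (cK n * cQ n) = ωgh n * cgh n ^ 2 * ((n : ℝ) ^ 2 * a) := by rw [hK n, hQ n]; ring
  rw [e, h2, show -(4 * N ^ 2 * (n : ℝ) ^ 4) * ((n : ℝ) ^ 2 * a) = -(4 * N ^ 2 * a * (n : ℝ) ^ 6) by ring, abs_neg,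
    abs_of_nonneg (by positivity)]

/-- [folklore] The same product in the order `cQ·cK` (the letter of `h₅_of_scaling`). -/
theorem abs_weight₅_le_of_ray (ha : 0 ≤ a) (hω : ∀ n : ℕ, 2 ≤ n → ωgh n * cK n ^ 2 = -2 * (ωgl n * cE n ^ 2))
    (hlam : ∀ n : ℕ, 2 ≤ n → ωgl n * cE n ^ 2 = 2 * N ^ 2 * (n : ℝ) ^ 8)
    (hK : ∀ n : ℕ, cK n = cgh n * (n : ℝ) ^ 2) (hQ : ∀ n : ℕ, cQ n = cgh n * a) :
    ∀ n : ℕ, 2 ≤ n → |ωgh n * (cQ n * cK n)| ≤ 4 * N ^ 2 * a * (n : ℝ) ^ 6 := by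
  intro n hn
  rw [mul_comm (cQ n)]
  exact abs_weight₄_le_of_ray ha hω hlam hK hQ n hn

/-- [folklore] **THE T₆ WEIGHT PRODUCT AT THE RAY**: `|ωgh n·(cQ n·cQ n)| ≤ 4N²a²·n⁴` — the letter of «NT-6» (U-1) with `k = 4N²a²`. -/
theorem abs_weight₆_le_of_ray (hω : ∀ n : ℕ, 2 ≤ n → ωgh n * cK n ^ 2 = -2 * (ωgl n * cE n ^ 2))
    (hlam : ∀ n : ℕ, 2 ≤ n → ωgl n * cE n ^ 2 = 2 * N ^ 2 * (n : ℝ) ^ 8)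
    (hK : ∀ n : ℕ, cK n = cgh n * (n : ℝ) ^ 2) (hQ : ∀ n : ℕ, cQ n = cgh n * a) :
    ∀ n : ℕ, 2 ≤ n → |ωgh n * (cQ n * cQ n)| ≤ 4 * N ^ 2 * a ^ 2 * (n : ℝ) ^ 4 := by
  intro n hn
  have h2 := ωgh_mul_cgh_sq_of_ray hω hlam hK n hn
  have e : ωgh n * (cQ n * cQ n) = ωgh n * cgh n ^ 2 * a ^ 2 := by rw [hQ n]; ring
  rw [e, h2, show -(4 * N ^ 2 * (n : ℝ) ^ 4) * a ^ 2 = -(4 * N ^ 2 * a ^ 2 * (n : ℝ) ^ 4) by ring, abs_neg,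
    abs_of_nonneg (by positivity)]

/-! ## §4 The T₄∕T₅ rows at the ray (gan24-leaf-05-g41's closer `NeedleGhostBubbleRowClosed.h₄∕h₅_of_scaling`, M10 inside) -/

/-- [folklore] **THE `ghCur ⊗ qA` ROW `h₄` AT THE RAY OF RECORD**: `h₄` of `NeedleRowGlue.abs_gN_row_le_of_tables` VERBATIM with
`C₄ := 4N²a·cNear(a)²·(2·((1 + 4∕ghDelta a)²·latticeConst 4 (ghDelta a∕2)))`; displayed `0 < a`, `hω`, `hlam`, `cK = cgh·n²`, `cQ = cgh·a`. -/
theorem h₄_of_ray (ha : 0 < a) (hω : ∀ n : ℕ, 2 ≤ n → ωgh n * cK n ^ 2 = -2 * (ωgl n * cE n ^ 2))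
    (hlam : ∀ n : ℕ, 2 ≤ n → ωgl n * cE n ^ 2 = 2 * N ^ 2 * (n : ℝ) ^ 8)
    (hK : ∀ n : ℕ, cK n = cgh n * (n : ℝ) ^ 2) (hQ : ∀ n : ℕ, cQ n = cgh n * a) (μ ν : Fin 4) :
    ∀ n : ℕ, 2 ≤ n → ∀ [NeZero n], |ωgh n * (cK n * cQ n) * ∑ b ∈ (univ : Finset (Fin 4 → Fin n)).image resSite, ((n : ℝ) ^ 4)⁻¹ *
      (((n : ℝ) ^ 8)⁻¹ * fullSum (fun w : Pt => toReal w μ * toReal w ν *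
        biBubbleTable (Ggh n a) (Ggh n a) ghCur (qAntiAt (ctrHalf n) n) μ ν (b + w) b))|
        ≤ 4 * N ^ 2 * a * cNear a ^ 2 * (2 * ((1 + 4 / ghDelta a) ^ 2 * latticeConst 4 (ghDelta a / 2))) :=
  h₄_of_scaling ha (abs_weight₄_le_of_ray ha.le hω hlam hK hQ) μ ν

/-- [folklore] **THE `qA ⊗ ghCur` ROW `h₅` AT THE RAY OF RECORD** (same constant). -/
theorem h₅_of_ray (ha : 0 < a) (hω : ∀ n : ℕ, 2 ≤ n → ωgh n * cK n ^ 2 = -2 * (ωgl n * cE n ^ 2))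
    (hlam : ∀ n : ℕ, 2 ≤ n → ωgl n * cE n ^ 2 = 2 * N ^ 2 * (n : ℝ) ^ 8)
    (hK : ∀ n : ℕ, cK n = cgh n * (n : ℝ) ^ 2) (hQ : ∀ n : ℕ, cQ n = cgh n * a) (μ ν : Fin 4) :
    ∀ n : ℕ, 2 ≤ n → ∀ [NeZero n], |ωgh n * (cQ n * cK n) * ∑ b ∈ (univ : Finset (Fin 4 → Fin n)).image resSite, ((n : ℝ) ^ 4)⁻¹ *
      (((n : ℝ) ^ 8)⁻¹ * fullSum (fun w : Pt => toReal w μ * toReal w ν *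
        biBubbleTable (Ggh n a) (Ggh n a) (qAntiAt (ctrHalf n) n) ghCur μ ν (b + w) b))|
        ≤ 4 * N ^ 2 * a * cNear a ^ 2 * (2 * ((1 + 4 / ghDelta a) ^ 2 * latticeConst 4 (ghDelta a / 2))) :=
  h₅_of_scaling ha (abs_weight₅_le_of_ray ha.le hω hlam hK hQ) μ ν

/-! ## §5 (v1.1) The T₇ row at the ray (leaf-04-g8's closer `NeedleGhostTadpoleRowClosed.h₇_of_scaling`, sharp count U-1, M10 at block distance 0) -/

open Summit.QuantumFields.BalabanUV.Beta.D1BFx.NeedleGhostTadpoleRowClosed (h₇_of_scaling) in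
/-- [folklore] **THE COMPLETED GHOST TADPOLE ROW `h₇` AT THE RAY OF RECORD**: `h₇` of `NeedleRowGlue.abs_gN_row_le_of_tables` VERBATIM with `C₇ := 4N²a·(cNear a + 2∕min 2 a)`; displayed `0 < a`, the END's `hω`∕`hlam`, and the ghost ray pins `cK = cgh·n²`, `cQ = cgh·a`, `x₀ = −cgh` — nothing else. -/
theorem h₇_of_ray (ha : 0 < a) (hω : ∀ n : ℕ, 2 ≤ n → ωgh n * cK n ^ 2 = -2 * (ωgl n * cE n ^ 2))
    (hlam : ∀ n : ℕ, 2 ≤ n → ωgl n * cE n ^ 2 = 2 * N ^ 2 * (n : ℝ) ^ 8)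
    (hK : ∀ n : ℕ, cK n = cgh n * (n : ℝ) ^ 2) (hQ : ∀ n : ℕ, cQ n = cgh n * a) (hx : ∀ n : ℕ, x₀ n = -cgh n) (μ ν : Fin 4) :
    ∀ n : ℕ, 2 ≤ n → ∀ [NeZero n], |ωgh n * ∑ b ∈ (univ : Finset (Fin 4 → Fin n)).image resSite, ((n : ℝ) ^ 4)⁻¹ * (((n : ℝ) ^ 8)⁻¹ *
      fullSum (fun w : Pt => toReal w μ * toReal w ν *
        tadpoleTableA (Ggh n a) (WghAt (ctrHalf n) n (x₀ n) (cK n) (cQ n)) μ ν (b + w) b))| ≤ 4 * N ^ 2 * a * (cNear a + 2 / min 2 a) :=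
  h₇_of_scaling ha (abs_weight₇_le_of_ray ha.le hω hlam hK hQ hx) μ ν

/-! ## §6 (v1.2) The T₆ row at the ray (gan24-leaf-05-g41's `NeedleGhostBubble2Row.h₆_of_scaling` over the owner's pointwise four-placement bound; signed `gq` block sums, no M10) -/

open B6QGQDecay237 (deltaU) in
open Summit.QuantumFields.BalabanUV.Beta.D1BFx.BlockColumnSupNorm (cG) in
open Summit.QuantumFields.BalabanUV.Beta.D1BFx.NeedleGhostBubble2Row (h₆_of_scaling) in
/-- [folklore] **THE TWO-NEEDLE GHOST BUBBLE ROW `h₆` AT THE RAY OF RECORD**: `h₆` of `NeedleRowGlue.abs_gN_row_le_of_tables` VERBATIM with `C₆ := 4N²a²·((cG² + cG·(2∕min 2 a))·((1 + 4∕δ_u)²·latticeConst 4 (δ_u∕2)))` (`cG = cG 4 a`, `δ_u = deltaU 4 a`); displayed `0 < a`, the END's `hω`∕`hlam`, and the ghost ray pins `cK = cgh·n²`, `cQ = cgh·a`. -/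
theorem h₆_of_ray (ha : 0 < a) (hω : ∀ n : ℕ, 2 ≤ n → ωgh n * cK n ^ 2 = -2 * (ωgl n * cE n ^ 2))
    (hlam : ∀ n : ℕ, 2 ≤ n → ωgl n * cE n ^ 2 = 2 * N ^ 2 * (n : ℝ) ^ 8)
    (hK : ∀ n : ℕ, cK n = cgh n * (n : ℝ) ^ 2) (hQ : ∀ n : ℕ, cQ n = cgh n * a) (μ ν : Fin 4) :
    ∀ n : ℕ, 2 ≤ n → ∀ [NeZero n], |ωgh n * (cQ n * cQ n) * ∑ b ∈ (univ : Finset (Fin 4 → Fin n)).image resSite, ((n : ℝ) ^ 4)⁻¹ *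
      (((n : ℝ) ^ 8)⁻¹ * fullSum (fun w : Pt => toReal w μ * toReal w ν *
        biBubbleTable (Ggh n a) (Ggh n a) (qAntiAt (ctrHalf n) n) (qAntiAt (ctrHalf n) n) μ ν (b + w) b))|
        ≤ 4 * N ^ 2 * a ^ 2 * (((cG 4 a) ^ 2 + cG 4 a * (2 / min 2 a)) * ((1 + 4 / deltaU 4 a) ^ 2 * latticeConst 4 (deltaU 4 a / 2))) :=
  h₆_of_scaling ha (abs_weight₆_le_of_ray hω hlam hK hQ) μ ν

end Summit.QuantumFields.BalabanUV.Beta.D1BFx.NeedleRowsAtRay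

end
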